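import Mathlib.Analysis.SpecialFunctions.Pow.Real
import HarnessLib

/-!
# Scalar zeroth law over a prescribed carrier — the constant budget

Cell `ad-ideate`, planner ad-ideate-p1 ROUND-10 §B3, Step 5 (bookkeeping): pure real arithmetic.
With `q ≤ 1/(2L)` the per-period contraction, `σ = ‖S‖_{L²}`, `R = Lσ/(1-q)` the asymptotic bound
on the energies `a_n = ‖w(nL)‖` at the period starts (`a_{n+1} ≤ q a_n + Lσ`), `m̄ = qR + σ` the
bound at the ends of the active units, `K ≥ ‖∑ᵢ aᵢ∂ᵢ∂ᵢS‖_{L²}` and `κ K L² ≤ σ`: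

* `geom_recursion_le` — `a_{n+1} ≤ q a_n + c` (`0 ≤ q < 1`) gives `a_n ≤ qⁿ a₀ + c/(1-q)`;
* `asymptotic_energy_le` — `R ≤ (24/23) L σ` for `L ≥ 12`, hence `R + Lσ ≤ 3Lσ` and
  `(R + Lσ)² ≤ 9 L² σ²` (conjunct (E));
* `floor_budget` — the per-period injection budget
  `-(L-1) m̄ σ + ½(L-1)² (σ² - κK(m̄ + (L-1)σ)) - σ(R + σ) ≥ (L²/2 - 5L) σ²` for `L ≥ 12`
  (conjunct (D): divided by the period `L` this is the floor `(L/2 - 5)σ²`).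

Supports stmt-AnomalousDissipation-0448 (prescribed-carrier rung; no statement about Navier–Stokes).
-/

noncomputable section

-- `Summit.<Summit>.<Problem>` is the tree's mandated summit-side namespace (CONVENTIONS §2); for this
-- single-conjunct summit the two coincide, so the duplicate is deliberate.
set_option linter.dupNamespace false

namespace Summit.AnomalousDissipation.AnomalousDissipation.Theorems.ScalarZerothLawKinematic

/-- **Geometric recursion**: `a_{n+1} ≤ q a_n + c` with `0 ≤ q < 1` gives
`a_n ≤ qⁿ a₀ + c/(1-q)` (`c ≥ 0`). -/
theorem geom_recursion_le {a : ℕ → ℝ} {q c : ℝ} (hq0 : 0 ≤ q) (hq1 : q < 1) (hc : 0 ≤ c)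
    (h : ∀ n, a (n + 1) ≤ q * a n + c) (n : ℕ) : a n ≤ q ^ n * a 0 + c / (1 - q) := by
  have h1q : 0 < 1 - q := by linarith
  induction n with
  | zero =>
    simp only [pow_zero, one_mul]
    have : 0 ≤ c / (1 - q) := div_nonneg hc h1q.le
    linarith
  | succ n ih =>
    have hstep := h n
    have e : q * (c / (1 - q)) + c = c / (1 - q) := by
      field_simp
      ring
    calc a (n + 1) ≤ q * a n + c := hstep
      _ ≤ q * (q ^ n * a 0 + c / (1 - q)) + c := by
          have := mul_le_mul_of_nonneg_left ih hq0
          linarith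
      _ = q ^ (n + 1) * a 0 + c / (1 - q) := by rw [pow_succ]; linear_combination e

/-- **The asymptotic energy bound**: if `R (1 - q) = L σ` with `0 ≤ q ≤ 1/24` then
`23 R ≤ 24 L σ`; in particular `R + L σ ≤ 3 L σ` (used with `‖w(t)‖ ≤ ‖θ₀‖ + R + Lσ` for (E∞))
and `(R + Lσ)² ≤ 9 L² σ²` (conjunct (E)). -/
theorem asymptotic_energy_le {q R L σ : ℝ} (hq : q ≤ 1 / 24) (hR0 : 0 ≤ R)
    (hσ : 0 ≤ σ) (hL : 0 ≤ L) (hR : R * (1 - q) = L * σ) :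
    23 * R ≤ 24 * (L * σ) ∧ R + L * σ ≤ 3 * L * σ ∧ (R + L * σ) ^ 2 ≤ 9 * L ^ 2 * σ ^ 2 := by
  have h1 : 23 * R ≤ 24 * (L * σ) := by nlinarith
  have h2 : R + L * σ ≤ 3 * L * σ := by nlinarith
  refine ⟨h1, h2, ?_⟩
  have h3 : 0 ≤ R + L * σ := by positivity
  calc (R + L * σ) ^ 2 ≤ (3 * L * σ) ^ 2 := pow_le_pow_left₀ h3 h2 2
    _ = 9 * L ^ 2 * σ ^ 2 := by ring

/-- **The floor budget.** For `L ≥ 12`, `0 ≤ q` with `2Lq ≤ 1`, `σ ≥ 0`, `K ≥ 0`, `κ ≥ 0` with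
`κ K L² ≤ σ`, and `R ≥ 0` with `R(1 - q) = Lσ`, the asymptotic injection per period is at least
`(L²/2 - 5L) σ²`:
`(L²/2 - 5L) σ² ≤ -(L-1)(qR + σ)σ + ½(L-1)² (σ² - κ K ((qR + σ) + (L-1)σ)) - σ (R + σ)`.
(Numerically: `R ≤ (24/23)Lσ`, `qR ≤ (12/23)σ`, the diffusive correction is `≤ ½(L+1)σ²`; the
right side is `≥ (L²/2 - 4.07 L + 0.52)σ²`.) -/
theorem floor_budget {L q σ K κ R : ℝ} (hL : 12 ≤ L) (hq0 : 0 ≤ q) (hq : q * (2 * L) ≤ 1)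
    (hσ : 0 ≤ σ) (hK : 0 ≤ K) (hκ : 0 ≤ κ) (hκK : κ * K * L ^ 2 ≤ σ) (hR0 : 0 ≤ R)
    (hR : R * (1 - q) = L * σ) :
    (L ^ 2 / 2 - 5 * L) * σ ^ 2 ≤
      -(L - 1) * (q * R + σ) * σ + (L - 1) ^ 2 / 2 * (σ ^ 2 - κ * K * ((q * R + σ) + (L - 1) * σ)) -
        σ * (R + σ) := by
  have hL0 : 0 < L := by linarith
  have hq24 : q ≤ 1 / 24 := by
    have : q * 24 ≤ q * (2 * L) := mul_le_mul_of_nonneg_left (by linarith) hq0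
    linarith
  -- `23 R ≤ 24 L σ` and `qR ≤ R/(2L) ≤ (12/23) σ`
  have hR1 : 23 * R ≤ 24 * (L * σ) := by nlinarith
  have hqR : q * R * (2 * L) ≤ R := by nlinarith
  have hqR' : 23 * (q * R) * L ≤ 12 * (L * σ) := by nlinarith
  have hqR'' : 23 * (q * R) ≤ 12 * σ :=
    le_of_mul_le_mul_right (show 23 * (q * R) * L ≤ 12 * σ * L by linarith) hL0
  -- the diffusive correction: `κ K ((qR + σ) + (L-1)σ) (L-1)²/2 ≤ (L+1) σ² / 2`
  have hm : q * R + σ + (L - 1) * σ ≤ (L + 1) * σ := by nlinarith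
  have hcorr0 : 0 ≤ κ * K := mul_nonneg hκ hK
  have hcorr1 : κ * K * ((q * R + σ) + (L - 1) * σ) ≤ κ * K * ((L + 1) * σ) :=
    mul_le_mul_of_nonneg_left hm hcorr0
  have hcorr2 : (L - 1) ^ 2 / 2 * (κ * K * ((L + 1) * σ)) ≤ (L + 1) * σ ^ 2 / 2 := by
    -- `(L-1)² ≤ L²` and `κ K L² ≤ σ`
    have h1 : (L - 1) ^ 2 ≤ L ^ 2 := by nlinarith
    have h2 : (L - 1) ^ 2 * (κ * K) ≤ L ^ 2 * (κ * K) := mul_le_mul_of_nonneg_right h1 hcorr0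
    have h3 : L ^ 2 * (κ * K) ≤ σ := by nlinarith
    have h4 : 0 ≤ (L + 1) * σ := by positivity
    nlinarith
  have hcorr : (L - 1) ^ 2 / 2 * (κ * K * ((q * R + σ) + (L - 1) * σ)) ≤ (L + 1) * σ ^ 2 / 2 := by
    have : (L - 1) ^ 2 / 2 * (κ * K * ((q * R + σ) + (L - 1) * σ)) ≤
        (L - 1) ^ 2 / 2 * (κ * K * ((L + 1) * σ)) := mul_le_mul_of_nonneg_left hcorr1 (by positivity)
    linarith
  -- assemble
  nlinarith [mul_nonneg hσ hσ, mul_nonneg (by linarith : (0 : ℝ) ≤ L - 12) (mul_nonneg hσ hσ)]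

end Summit.AnomalousDissipation.AnomalousDissipation.Theorems.ScalarZerothLawKinematic

end
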